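import Mathlib.Probability.Distributions.Beta
import Literature.NumberTheory.Transcendental.GammaMonomials
import Literature.NumberTheory.Transcendental.GammaMonomialsProofs

/-!
# `BetaProductSector` (stmt-KontsevichZagierPeriods-3898), line `registered` v3 — stub `stub_linConstantRaw`

HODGE-EQUAL BETA ATOMS HAVE ALGEBRAICALLY PROPORTIONAL VALUES (Deligne, LNM 900, Thm. 7.18 (a);
elementary proof of Koblitz–Ogus). If two Beta atoms `B(a₁,b₁)`, `B(a₂,b₂)` (positive rational
arguments) have the same Deligne–Koblitz–Ogus Hodge function
`ε_{a,b}(u) = {ua} + {ub} − {u(a+b)}` at every `u ≥ 1` coprime to the denominators, then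
`B(a₁,b₁) = c · B(a₂,b₂)` with `c > 0` real algebraic.

Proof. Choose a common level `D > 1` (`D = 2·den a₁·den b₁·den a₂·den b₂`) and write every argument as
`m/D`, `m ≥ 1`. Translating to `(0,1]` by `Γ(x+1) = xΓ(x)` gives `Γ(m/D) = q·Γ((m mod D)/D)` with
`q ∈ ℚ_{>0}` (the Γ-factor being `1` when `D ∣ m`), so
`B(m/D,k/D) = q'·∏_{0<i<D} Γ(i/D)^{[i = m mod D] + [i = k mod D] − [i = (m+k) mod D]}` and the quotient
`B(a₁,b₁)/B(a₂,b₂)` is a positive rational times the Γ-monomial with multiplicities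
`n = n⁽¹⁾ − n⁽²⁾`. Since `{u·(m mod D)/D} = {u·m/D}`, the Hodge-type sum `Σ n_i {ui/D}` is
`ε₁(u) − ε₂(u) = 0` for every `u` coprime to `D` (such `u` are `≥ 1` and coprime to the four
denominators, which divide `D`): the monomial is of Hodge type with `c = 0`, hence algebraic by the
tree's PROVED discharge `deligne_gammaMonomial_algebraic_holds` of Deligne's Thm. 7.18 (a)
(`gammaTilde D n 0 = ∏ Γ(i/D)^{n_i}` as a complex number; back to `ℝ` by `isAlgebraic_of_ofReal`).
Positivity of `c = B(a₁,b₁)/B(a₂,b₂)` is `ProbabilityTheory.beta_pos`.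

References: P. Deligne, *Hodge cycles on abelian varieties*, LNM 900 (1982), §7, Thm. 7.18 (a) and
Rem. 7.16 (a) (appendix of Koblitz–Ogus to Deligne 1979) [Deligne1982HodgeCycles].
-/

noncomputable section

open Finset

namespace Summit.KontsevichZagierPeriods.FermatIsogeny.BetaProductSectorStubs

open Literature.NumberTheory.Transcendental
open Literature.NumberTheory.Transcendental.KoblitzOgus (isAlgebraic_of_ofReal)

/-! ## Bookkeeping over `{1, …, D-1}` -/

/-- `Σ_{0<i<D} [i = r]·F(i) = F(r)` for `r < D`, provided `F(0) = 0`. [folklore] -/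
private theorem sum_Ico_ite_mul {D r : ℕ} (hr : r < D) (F : ℕ → ℚ) (hF : F 0 = 0) :
    ∑ i ∈ Ico 1 D, (if i = r then (1:ℚ) else 0) * F i = F r := by
  simp_rw [boole_mul]
  rw [sum_ite_eq']
  by_cases h0 : r = 0
  · subst h0
    simp [hF]
  · rw [if_pos (mem_Ico.mpr ⟨Nat.one_le_iff_ne_zero.mpr h0, hr⟩)]

/-- `Π_{0<i<D} G(i)^{[i = r]}` is `G(r)` for `0 < r < D` and `1` for `r = 0`. [folklore] -/
private theorem prod_Ico_zpow_ite {D r : ℕ} (hr : r < D) (G : ℕ → ℝ) :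
    ∏ i ∈ Ico 1 D, G i ^ (if i = r then (1:ℤ) else 0) = if r = 0 then 1 else G r := by
  have h : ∀ i, G i ^ (if i = r then (1:ℤ) else 0) = if i = r then G i else 1 := fun i => by
    split_ifs <;> simp
  simp_rw [h]
  rw [prod_ite_eq']
  by_cases h0 : r = 0
  · subst h0
    simp
  · rw [if_pos (mem_Ico.mpr ⟨Nat.one_le_iff_ne_zero.mpr h0, hr⟩), if_neg h0]

/-- `{u·(m mod D)/D} = {u·m/D}`. [folklore] -/
private theorem fract_mul_mod_div (D u m : ℕ) :
    Int.fract ((u:ℚ) * ((m % D : ℕ) : ℚ) / D) = Int.fract ((u:ℚ) * (m:ℚ) / D) := by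
  rw [show (u:ℚ) * ((m % D : ℕ) : ℚ) = ((u * (m % D) : ℕ) : ℚ) by push_cast; ring,
    show (u:ℚ) * (m:ℚ) = ((u * m : ℕ) : ℚ) by push_cast; ring,
    Int.fract_div_natCast_eq_div_natCast_mod, Int.fract_div_natCast_eq_div_natCast_mod,
    Nat.mul_mod, Nat.mod_mod, ← Nat.mul_mod]

/-! ## Translation of `Γ` to `(0,1]` -/

/-- Translation: `Γ((r + D t)/D) = q · Γ(r/D)` for `r + D t ≥ 1` (`q ∈ ℚ_{>0}`; the Γ-factor is
read as `1` when `r = 0`), by `Γ(x+1) = xΓ(x)` and `Γ(1) = 1`. [folklore] -/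
private theorem gamma_translate {D : ℕ} (hD : 0 < D) (r : ℕ) :
    ∀ t : ℕ, 0 < r + D * t → ∃ q : ℚ, 0 < q ∧
      Real.Gamma (((r + D * t : ℕ) : ℝ) / D) = q * (if r = 0 then 1 else Real.Gamma ((r:ℝ) / D)) := by
  have hD' : (D:ℝ) ≠ 0 := by exact_mod_cast hD.ne'
  intro t
  induction t with
  | zero =>
    intro hpos
    have hr0 : r ≠ 0 := by simpa using hpos.ne'
    refine ⟨1, one_pos, ?_⟩
    simp [hr0]
  | succ t ih =>
    intro _
    rcases Nat.eq_zero_or_pos (r + D * t) with h0 | hpos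
    · have hr0 : r = 0 := by omega
      refine ⟨1, one_pos, ?_⟩
      have h1 : ((r + D * (t + 1) : ℕ) : ℝ) / D = 1 := by
        rw [Nat.mul_succ, ← add_assoc, h0, zero_add, div_self hD']
      rw [h1, Real.Gamma_one, if_pos hr0]
      simp
    · obtain ⟨q, hq, hΓ⟩ := ih hpos
      have hs : ((r + D * (t + 1) : ℕ) : ℝ) / D = ((r + D * t : ℕ) : ℝ) / D + 1 := by
        push_cast
        field_simp
        ring
      have hs0 : ((r + D * t : ℕ) : ℝ) / D ≠ 0 := div_ne_zero (by exact_mod_cast hpos.ne') hD'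
      refine ⟨((r + D * t : ℕ) : ℚ) / D * q,
        mul_pos (div_pos (by exact_mod_cast hpos) (by exact_mod_cast hD)) hq, ?_⟩
      rw [hs, Real.Gamma_add_one hs0, hΓ]
      push_cast
      ring

/-- Translation for `m ≥ 1`: `Γ(m/D) = q · Γ((m mod D)/D)` with `q ∈ ℚ_{>0}` (the Γ-factor read as
`1` when `D ∣ m`, where `Γ(m/D)` is a factorial). [folklore] -/
private theorem gamma_div_eq {D : ℕ} (hD : 0 < D) {m : ℕ} (hm : 0 < m) :
    ∃ q : ℚ, 0 < q ∧ Real.Gamma ((m:ℝ) / D) =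
      q * (if m % D = 0 then 1 else Real.Gamma (((m % D : ℕ) : ℝ) / D)) := by
  have h := gamma_translate hD (m % D) (m / D) (by rw [Nat.mod_add_div]; exact hm)
  rwa [Nat.mod_add_div] at h

/-- A Beta atom of level `D` is a positive rational times the Γ-monomial on `{1/D, …, (D-1)/D}` with
multiplicities `[i = m mod D] + [i = k mod D] − [i = (m+k) mod D]`. [folklore] -/
private theorem beta_eq_rat_mul_prod {D : ℕ} (hD : 0 < D) {m k : ℕ} (hm : 0 < m) (hk : 0 < k) :
    ∃ q : ℚ, 0 < q ∧ ProbabilityTheory.beta ((m:ℝ) / D) ((k:ℝ) / D) =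
      q * ∏ i ∈ Ico 1 D, Real.Gamma ((i:ℝ) / D) ^
        ((if i = m % D then (1:ℤ) else 0) + (if i = k % D then (1:ℤ) else 0) -
          (if i = (m + k) % D then (1:ℤ) else 0)) := by
  obtain ⟨q₁, hq₁, h₁⟩ := gamma_div_eq hD hm
  obtain ⟨q₂, hq₂, h₂⟩ := gamma_div_eq hD hk
  obtain ⟨q₃, hq₃, h₃⟩ := gamma_div_eq hD (Nat.add_pos_left hm k)
  have hsplit : ∏ i ∈ Ico 1 D, Real.Gamma ((i:ℝ) / D) ^
      ((if i = m % D then (1:ℤ) else 0) + (if i = k % D then (1:ℤ) else 0) -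
        (if i = (m + k) % D then (1:ℤ) else 0)) =
      (∏ i ∈ Ico 1 D, Real.Gamma ((i:ℝ) / D) ^ (if i = m % D then (1:ℤ) else 0)) *
        (∏ i ∈ Ico 1 D, Real.Gamma ((i:ℝ) / D) ^ (if i = k % D then (1:ℤ) else 0)) /
        ∏ i ∈ Ico 1 D, Real.Gamma ((i:ℝ) / D) ^ (if i = (m + k) % D then (1:ℤ) else 0) := by
    rw [← prod_mul_distrib, ← prod_div_distrib]
    refine prod_congr rfl fun i hi => ?_
    have hGi : Real.Gamma ((i:ℝ) / D) ≠ 0 :=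
      (Real.Gamma_pos_of_pos (div_pos (by exact_mod_cast (mem_Ico.mp hi).1)
        (by exact_mod_cast hD))).ne'
    rw [zpow_sub₀ hGi, zpow_add₀ hGi]
  refine ⟨q₁ * q₂ / q₃, by positivity, ?_⟩
  rw [hsplit, prod_Ico_zpow_ite (Nat.mod_lt m hD), prod_Ico_zpow_ite (Nat.mod_lt k hD),
    prod_Ico_zpow_ite (Nat.mod_lt (m + k) hD), ProbabilityTheory.beta,
    show (m:ℝ) / D + (k:ℝ) / D = ((m + k : ℕ) : ℝ) / D by push_cast; ring, h₁, h₂, h₃]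
  push_cast
  ring

/-- The Hodge-type sum of the multiplicity vector of one atom is its Hodge term:
`Σ_{0<i<D} ([i = m mod D] + [i = k mod D] − [i = (m+k) mod D])·{ui/D} = {um/D} + {uk/D} − {u(m+k)/D}`.
[folklore] -/
private theorem sum_indicator_fract {D : ℕ} (hD : 0 < D) (u m k : ℕ) :
    ∑ i ∈ Ico 1 D, (((if i = m % D then (1:ℤ) else 0) + (if i = k % D then (1:ℤ) else 0) -
        (if i = (m + k) % D then (1:ℤ) else 0) : ℤ) : ℚ) * Int.fract ((u:ℚ) * i / D) =
      Int.fract ((u:ℚ) * ((m:ℚ) / D)) + Int.fract ((u:ℚ) * ((k:ℚ) / D)) -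
        Int.fract ((u:ℚ) * ((m:ℚ) / D + (k:ℚ) / D)) := by
  have hF : ∀ r, r < D → ∑ i ∈ Ico 1 D, (if i = r then (1:ℚ) else 0) * Int.fract ((u:ℚ) * i / D) =
      Int.fract ((u:ℚ) * (r:ℚ) / D) :=
    fun r hr => sum_Ico_ite_mul hr (fun i => Int.fract ((u:ℚ) * i / D)) (by simp)
  push_cast
  simp_rw [sub_mul, add_mul, sum_sub_distrib, sum_add_distrib]
  rw [hF _ (Nat.mod_lt m hD), hF _ (Nat.mod_lt k hD), hF _ (Nat.mod_lt (m + k) hD),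
    fract_mul_mod_div, fract_mul_mod_div, fract_mul_mod_div,
    show (u:ℚ) * ((m + k : ℕ) : ℚ) / D = (u:ℚ) * ((m:ℚ) / D + (k:ℚ) / D) by push_cast; ring,
    mul_div_assoc, mul_div_assoc]

/-! ## The quotient of two Hodge-equal atoms of level `D` is algebraic -/

/-- **Koblitz–Ogus for a pair of atoms at level `D`.** If the Hodge terms of `B(m₁/D,k₁/D)` and
`B(m₂/D,k₂/D)` agree at every `u` coprime to `D`, then `B(m₁/D,k₁/D)/B(m₂/D,k₂/D)` is algebraic:
it is a rational multiple of a weight-`0` Γ-monomial of Hodge type, algebraic by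
`deligne_gammaMonomial_algebraic_holds`. [cite: Deligne1982HodgeCycles, Thm. 7.18] -/
private theorem isAlgebraic_beta_div_beta {D : ℕ} (hD : 1 < D) {m₁ k₁ m₂ k₂ : ℕ}
    (hm₁ : 0 < m₁) (hk₁ : 0 < k₁) (hm₂ : 0 < m₂) (hk₂ : 0 < k₂)
    (hH : ∀ u : ℕ, Nat.Coprime u D →
      Int.fract ((u:ℚ) * ((m₁:ℚ) / D)) + Int.fract ((u:ℚ) * ((k₁:ℚ) / D)) -
          Int.fract ((u:ℚ) * ((m₁:ℚ) / D + (k₁:ℚ) / D)) =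
        Int.fract ((u:ℚ) * ((m₂:ℚ) / D)) + Int.fract ((u:ℚ) * ((k₂:ℚ) / D)) -
          Int.fract ((u:ℚ) * ((m₂:ℚ) / D + (k₂:ℚ) / D))) :
    IsAlgebraic ℚ (ProbabilityTheory.beta ((m₁:ℝ) / D) ((k₁:ℝ) / D) /
      ProbabilityTheory.beta ((m₂:ℝ) / D) ((k₂:ℝ) / D)) := by
  have hD0 : 0 < D := by omega
  -- the multiplicity vector `n = n⁽¹⁾ − n⁽²⁾`
  obtain ⟨n, hn⟩ : ∃ n : ℕ → ℤ, ∀ i, n i =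
      ((if i = m₁ % D then (1:ℤ) else 0) + (if i = k₁ % D then (1:ℤ) else 0) -
        (if i = (m₁ + k₁) % D then (1:ℤ) else 0)) -
      ((if i = m₂ % D then (1:ℤ) else 0) + (if i = k₂ % D then (1:ℤ) else 0) -
        (if i = (m₂ + k₂) % D then (1:ℤ) else 0)) := ⟨_, fun i => rfl⟩
  -- it is of Hodge type with `c = 0`
  have hHT : IsHodgeTypeGammaMonomial D n 0 := by
    intro u hu
    have e : ∀ i ∈ Ico 1 D, (n i : ℚ) * Int.fract ((u:ℚ) * i / D) =
        (((if i = m₁ % D then (1:ℤ) else 0) + (if i = k₁ % D then (1:ℤ) else 0) -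
            (if i = (m₁ + k₁) % D then (1:ℤ) else 0) : ℤ) : ℚ) * Int.fract ((u:ℚ) * i / D) -
          (((if i = m₂ % D then (1:ℤ) else 0) + (if i = k₂ % D then (1:ℤ) else 0) -
            (if i = (m₂ + k₂) % D then (1:ℤ) else 0) : ℤ) : ℚ) * Int.fract ((u:ℚ) * i / D) := by
      intro i _
      rw [hn, Int.cast_sub, sub_mul]
    rw [sum_congr rfl e, sum_sub_distrib, sum_indicator_fract hD0, sum_indicator_fract hD0, hH u hu,
      sub_self, Int.cast_zero]
  -- hence the real Γ-monomial is algebraic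
  have hKO := deligne_gammaMonomial_algebraic_holds D n 0 hD hHT
  unfold gammaTilde at hKO
  rw [neg_zero, zpow_zero, one_mul] at hKO
  simp_rw [← Complex.ofReal_zpow] at hKO
  rw [← Complex.ofReal_prod] at hKO
  have hP : IsAlgebraic ℚ (∏ i ∈ Ico 1 D, Real.Gamma ((i:ℝ) / D) ^ n i) := isAlgebraic_of_ofReal hKO
  -- split the monomial as monomial⁽¹⁾ / monomial⁽²⁾
  have hsplit : ∏ i ∈ Ico 1 D, Real.Gamma ((i:ℝ) / D) ^ n i =
      (∏ i ∈ Ico 1 D, Real.Gamma ((i:ℝ) / D) ^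
        ((if i = m₁ % D then (1:ℤ) else 0) + (if i = k₁ % D then (1:ℤ) else 0) -
          (if i = (m₁ + k₁) % D then (1:ℤ) else 0))) /
      ∏ i ∈ Ico 1 D, Real.Gamma ((i:ℝ) / D) ^
        ((if i = m₂ % D then (1:ℤ) else 0) + (if i = k₂ % D then (1:ℤ) else 0) -
          (if i = (m₂ + k₂) % D then (1:ℤ) else 0)) := by
    rw [← prod_div_distrib]
    refine prod_congr rfl fun i hi => ?_
    have hGi : Real.Gamma ((i:ℝ) / D) ≠ 0 :=
      (Real.Gamma_pos_of_pos (div_pos (by exact_mod_cast (mem_Ico.mp hi).1)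
        (by exact_mod_cast hD0))).ne'
    rw [hn, zpow_sub₀ hGi]
  rw [hsplit] at hP
  obtain ⟨q₁, hq₁, hB₁⟩ := beta_eq_rat_mul_prod hD0 hm₁ hk₁
  obtain ⟨q₂, hq₂, hB₂⟩ := beta_eq_rat_mul_prod hD0 hm₂ hk₂
  rw [hB₁, hB₂, mul_div_mul_comm]
  exact ((isAlgebraic_rat ℚ q₁).mul (isAlgebraic_rat ℚ q₂).inv).mul hP

/-- Every positive rational whose denominator divides `D > 0` is `m/D` with `m ≥ 1`. [folklore] -/
private theorem exists_numerator {D : ℕ} (hD : 0 < D) {a : ℚ} (ha : 0 < a) (hdvd : a.den ∣ D) :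
    ∃ m : ℕ, 0 < m ∧ a = (m:ℚ) / D := by
  obtain ⟨c, hc⟩ := hdvd
  have hc0 : 0 < c := Nat.pos_of_ne_zero (by rintro rfl; simp [hc] at hD)
  have hnum : 0 < a.num := Rat.num_pos.mpr ha
  have h1 : ((a.num.toNat : ℕ) : ℚ) = (a.num : ℚ) := by exact_mod_cast Int.toNat_of_nonneg hnum.le
  have hc' : (c : ℚ) ≠ 0 := by exact_mod_cast hc0.ne'
  refine ⟨a.num.toNat * c, Nat.mul_pos (by omega) hc0, ?_⟩
  rw [hc, Nat.cast_mul, Nat.cast_mul, mul_div_mul_right _ _ hc', h1, Rat.num_div_den]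

/-- **Stub `stub_linConstantRaw` — Hodge-equal Beta atoms are algebraically proportional**
(Deligne, LNM 900, Thm. 7.18 (a), via the elementary proof of Koblitz–Ogus, PROVED in the tree as
`deligne_gammaMonomial_algebraic_holds`). If `ε_{a₁,b₁}(u) = ε_{a₂,b₂}(u)` for every `u ≥ 1`
coprime to the four denominators (`ε_{a,b}(u) = {ua} + {ub} − {u(a+b)}`), then
`B(a₁,b₁) = c · B(a₂,b₂)` with `c = B(a₁,b₁)/B(a₂,b₂) > 0` real algebraic: at a common level
`D > 1` the quotient is a positive rational times the weight-`0` Γ-monomial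
`∏ Γ(i/D)^{n⁽¹⁾_i − n⁽²⁾_i}`, whose Hodge-type sum at `u` is `ε₁(u) − ε₂(u) = 0`.
[cite: Deligne1982HodgeCycles, Thm. 7.18] -/
theorem stub_linConstantRaw : ∀ (a₁ b₁ a₂ b₂ : ℚ), 0 < a₁ → 0 < b₁ → 0 < a₂ → 0 < b₂ → (∀ u : ℕ, 0 < u → Nat.Coprime u a₁.den → Nat.Coprime u b₁.den → Nat.Coprime u a₂.den → Nat.Coprime u b₂.den → Int.fract ((u:ℚ) * a₁) + Int.fract ((u:ℚ) * b₁) - Int.fract ((u:ℚ) * (a₁ + b₁)) = Int.fract ((u:ℚ) * a₂) + Int.fract ((u:ℚ) * b₂) - Int.fract ((u:ℚ) * (a₂ + b₂))) → ∃ c : ℝ, IsAlgebraic ℚ c ∧ 0 < c ∧ ProbabilityTheory.beta (a₁:ℝ) b₁ = c * ProbabilityTheory.beta (a₂:ℝ) b₂ := by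
  intro a₁ b₁ a₂ b₂ ha₁ hb₁ ha₂ hb₂ hH
  -- a common level `D > 1`
  obtain ⟨D, hD1, hDa₁, hDb₁, hDa₂, hDb₂⟩ :
      ∃ D : ℕ, 1 < D ∧ a₁.den ∣ D ∧ b₁.den ∣ D ∧ a₂.den ∣ D ∧ b₂.den ∣ D := by
    refine ⟨2 * (a₁.den * b₁.den * (a₂.den * b₂.den)), ?_,
      ⟨2 * b₁.den * (a₂.den * b₂.den), by ring⟩, ⟨2 * a₁.den * (a₂.den * b₂.den), by ring⟩,
      ⟨2 * (a₁.den * b₁.den) * b₂.den, by ring⟩, ⟨2 * (a₁.den * b₁.den) * a₂.den, by ring⟩⟩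
    have := Nat.mul_pos (Nat.mul_pos a₁.den_pos b₁.den_pos) (Nat.mul_pos a₂.den_pos b₂.den_pos)
    omega
  have hD0 : 0 < D := by omega
  obtain ⟨m₁, hm₁, e₁⟩ := exists_numerator hD0 ha₁ hDa₁
  obtain ⟨k₁, hk₁, f₁⟩ := exists_numerator hD0 hb₁ hDb₁
  obtain ⟨m₂, hm₂, e₂⟩ := exists_numerator hD0 ha₂ hDa₂
  obtain ⟨k₂, hk₂, f₂⟩ := exists_numerator hD0 hb₂ hDb₂
  have hB₁ : 0 < ProbabilityTheory.beta (a₁:ℝ) b₁ :=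
    ProbabilityTheory.beta_pos (Rat.cast_pos.mpr ha₁) (Rat.cast_pos.mpr hb₁)
  have hB₂ : 0 < ProbabilityTheory.beta (a₂:ℝ) b₂ :=
    ProbabilityTheory.beta_pos (Rat.cast_pos.mpr ha₂) (Rat.cast_pos.mpr hb₂)
  refine ⟨ProbabilityTheory.beta (a₁:ℝ) b₁ / ProbabilityTheory.beta (a₂:ℝ) b₂, ?_, div_pos hB₁ hB₂,
    (div_mul_cancel₀ _ hB₂.ne').symm⟩
  -- the Hodge hypothesis at level `D`: units mod `D` are `≥ 1` and coprime to the four denominators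
  have key := isAlgebraic_beta_div_beta hD1 hm₁ hk₁ hm₂ hk₂ (fun u hu => by
    have hu0 : 0 < u := Nat.pos_of_ne_zero (by
      rintro rfl
      exact absurd ((Nat.coprime_zero_left _).mp hu) hD1.ne')
    have h := hH u hu0 (Nat.Coprime.coprime_dvd_right hDa₁ hu) (Nat.Coprime.coprime_dvd_right hDb₁ hu)
      (Nat.Coprime.coprime_dvd_right hDa₂ hu) (Nat.Coprime.coprime_dvd_right hDb₂ hu)
    rwa [e₁, f₁, e₂, f₂] at h)
  rw [e₁, f₁, e₂, f₂]
  push_cast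
  exact key

end Summit.KontsevichZagierPeriods.FermatIsogeny.BetaProductSectorStubs

end
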